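import Summits.ResolutionOfSingularities.ResolutionOfSingularities.Theorems.EigenLadderLU1B
import HarnessLib

/-!
[WRITER NOTE (decomp-res writer g12): imports `EigenLadderLU1B` (the 400-line split of the lens's
`EigenLadderLU`) instead of `EigenLadderLU`; content otherwise verbatim.]

# EigenLadderLU (2) — PART C2 (Hermite basis of the invariant monomials, algebraic independence) and
PART B (the frame is COMPUTED: eigen-coordinates by Reynolds averaging with value control)

[WRITER NOTE (decomp-res writer g12): the gate caps Theorems files with proofs at 400 lines, so the
lens's tree file `EigenLadderLU2.lean` (455 l, sha256 a5c2fc0d…) is landed as TWO modules split at a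
namespace-block boundary — `EigenLadderLU2` (PART C2 invariant generators (Hermite basis `invGen`,
`fixed_iff_mem_adjoin_invGen`, algebraic independence)) and `EigenLadderLU2B` (PART B
eigen-coordinates by Reynolds averaging) — content VERBATIM (plus bookkeeping docstrings on
undocumented simp lemmas); the node's import chain becomes EigenLadderLU → EigenLadderLU1B →
EigenLadderLU2 → EigenLadderLU2B → EigenLadderLU3 → EigenLadderLU4 → EigenLadderLU5 →
EigenLadderLU5B → EigenLadderLU6 (one namespace `…Theorems.EigenLadderLU` throughout).]
-/

namespace Summit.ResolutionOfSingularities.ResolutionOfSingularities.Theorems.EigenLadderLU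

/-! ## PART C2 — the invariant sub-top has EXPLICIT monomial generators (characters `t`, `t₀ = 1`):
`k(x)^σ = k(W)`, `W = (x₀^ℓ, x₁x₀^{(ℓ-1)t₁}, x₂x₀^{(ℓ-1)t₂}, x₃x₀^{(ℓ-1)t₃})` -/

section Generators

variable {k : Type} [Field k] {L : Type} [Field L] [Algebra k L]

/-- The invariant monomial generators of a diagonal action with characters `t`, `t 0 = 1`:
`W₀ = x₀^ℓ`, `W_j = x_j · x₀^{(ℓ-1)t_j}` (`j ≥ 1`) — POLYNOMIAL monomials (they lie in the chart algebra),
a basis of the lattice of invariant exponents `{b : ℓ ∣ ⟨b, t⟩}`. [folklore] -/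
noncomputable def invGen (x : Fin 4 → L) (ℓ : ℕ) (t : Fin 4 → ℕ) : Fin 4 → L :=
  fun j => if j = 0 then x 0 ^ ℓ else x j * x 0 ^ ((ℓ - 1) * t j)

/-- `invGen_zero`: Bookkeeping / simp lemma of the eigen-ladder kernel (decomp-res lens-1 g24 «EigenLadder»),
VERBATIM from the lens's tree file (see the module docstring); the statement is its type. [folklore] -/
theorem invGen_zero (x : Fin 4 → L) (ℓ : ℕ) (t : Fin 4 → ℕ) : invGen x ℓ t 0 = x 0 ^ ℓ :=
  if_pos rfl

/-- `invGen_succ`: Bookkeeping / simp lemma of the eigen-ladder kernel (decomp-res lens-1 g24 «EigenLadder»),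
VERBATIM from the lens's tree file (see the module docstring); the statement is its type. [folklore] -/
theorem invGen_succ (x : Fin 4 → L) (ℓ : ℕ) (t : Fin 4 → ℕ) (i : Fin 3) :
    invGen x ℓ t i.succ = x i.succ * x 0 ^ ((ℓ - 1) * t i.succ) :=
  if_neg (Fin.succ_ne_zero i)

/-- The generators lie in any subalgebra containing the coordinates. [folklore] -/
theorem invGen_mem (x : Fin 4 → L) (ℓ : ℕ) (t : Fin 4 → ℕ) (A : Subalgebra k L)
    (hx : ∀ j, x j ∈ A) (j : Fin 4) : invGen x ℓ t j ∈ A := by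
  by_cases hj : j = 0
  · rw [hj, invGen_zero]; exact pow_mem (hx 0) _
  · obtain ⟨i, rfl⟩ : ∃ i : Fin 3, j = i.succ := ⟨j.pred hj, (Fin.succ_pred j hj).symm⟩
    rw [invGen_succ]; exact mul_mem (hx _) (pow_mem (hx 0) _)

/-- The generators are non-zero. [folklore] -/
theorem invGen_ne_zero (x : Fin 4 → L) (hx0 : ∀ j, x j ≠ 0) (ℓ : ℕ) (t : Fin 4 → ℕ) (j : Fin 4) :
    invGen x ℓ t j ≠ 0 := by
  by_cases hj : j = 0
  · rw [hj, invGen_zero]; exact pow_ne_zero _ (hx0 0)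
  · obtain ⟨i, rfl⟩ : ∃ i : Fin 3, j = i.succ := ⟨j.pred hj, (Fin.succ_pred j hj).symm⟩
    rw [invGen_succ]; exact mul_ne_zero (hx0 _) (pow_ne_zero _ (hx0 0))

/-- The generators are `σ`-INVARIANT (`ζ^ℓ = 1`, `t₀ = 1`). [folklore] -/
theorem sigma_invGen (σ : L ≃ₐ[k] L) (x : Fin 4 → L) {ζ : k} {ℓ : ℕ} (hℓ : 0 < ℓ)
    (hζℓ : ζ ^ ℓ = 1) (t : Fin 4 → ℕ) (ht0 : t 0 = 1)
    (heig : ∀ j, σ (x j) = algebraMap k L (ζ ^ t j) * x j)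
    (j : Fin 4) : σ (invGen x ℓ t j) = invGen x ℓ t j := by
  have h0 : σ (x 0) = algebraMap k L ζ * x 0 := by rw [heig, ht0, pow_one]
  by_cases hj : j = 0
  · rw [hj, invGen_zero, map_pow, h0, mul_pow, ← map_pow, hζℓ, map_one, one_mul]
  · obtain ⟨i, rfl⟩ : ∃ i : Fin 3, j = i.succ := ⟨j.pred hj, (Fin.succ_pred j hj).symm⟩
    rw [invGen_succ, map_mul, map_pow, heig, h0, mul_pow, ← map_pow]
    have hc : algebraMap k L (ζ ^ t i.succ) * algebraMap k L (ζ ^ ((ℓ - 1) * t i.succ)) = 1 := by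
      rw [← map_mul, ← pow_add, ← map_one (algebraMap k L)]
      congr 1
      have : t i.succ + (ℓ - 1) * t i.succ = ℓ * t i.succ := by
        rw [add_comm, ← Nat.succ_mul, Nat.succ_eq_add_one, Nat.sub_add_cancel hℓ]
      rw [this, pow_mul, hζℓ, one_pow]
    linear_combination (x i.succ * x 0 ^ ((ℓ - 1) * t i.succ)) * hc

/-- The exponent vectors of the generators. [folklore] -/
def invGenExp (ℓ : ℕ) (t : Fin 4 → ℕ) : Fin 4 → Fin 4 → ℤ :=
  fun j m => if j = 0 then (if m = 0 then (ℓ : ℤ) else 0)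
    else (if m = j then 1 else 0) + (if m = 0 then (((ℓ - 1) * t j : ℕ) : ℤ) else 0)

/-- `lmon_invGenExp`: Bookkeeping / simp lemma of the eigen-ladder kernel (decomp-res lens-1 g24
«EigenLadder»), VERBATIM from the lens's tree file (see the module docstring); the statement is its type. [folklore] -/
theorem lmon_invGenExp (x : Fin 4 → L) (_hx0 : ∀ j, x j ≠ 0) (ℓ : ℕ) (t : Fin 4 → ℕ) (j : Fin 4) :
    lmon x (invGenExp ℓ t j) = invGen x ℓ t j := by
  by_cases hj : j = 0
  · rw [hj, invGen_zero, lmon_def, Fin.prod_univ_succ]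
    have h1 : ∏ i : Fin 3, x i.succ ^ invGenExp ℓ t 0 i.succ = 1 :=
      Finset.prod_eq_one fun i _ => by simp [invGenExp, Fin.succ_ne_zero]
    rw [h1, mul_one]
    simp [invGenExp]
  · obtain ⟨i, rfl⟩ : ∃ i : Fin 3, j = i.succ := ⟨j.pred hj, (Fin.succ_pred j hj).symm⟩
    rw [invGen_succ, lmon_def, Fin.prod_univ_succ]
    have h0 : x 0 ^ invGenExp ℓ t i.succ 0 = x 0 ^ ((ℓ - 1) * t i.succ) := by
      have : invGenExp ℓ t i.succ 0 = (((ℓ - 1) * t i.succ : ℕ) : ℤ) := by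
        simp [invGenExp, (Fin.succ_ne_zero i).symm]
      rw [this, zpow_natCast]
    have h1 : ∏ m : Fin 3, x m.succ ^ invGenExp ℓ t i.succ m.succ = x i.succ := by
      rw [Finset.prod_eq_single i]
      · simp [invGenExp, Fin.succ_ne_zero]
      · intro m _ hm
        simp [invGenExp, Fin.succ_ne_zero, (Fin.succ_injective _).ne hm]
      · intro h; exact absurd (Finset.mem_univ i) h
    rw [h0, h1, mul_comm]

/-- **LATTICE BASIS**: every invariant exponent vector `b` (`ℓ ∣ ⟨b, t⟩`, `t₀ = 1`) is an INTEGER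
combination of the generator exponents: `b = q • B₀ + ∑_{j ≥ 1} b_j • B_j`. [folklore] -/
theorem exists_eq_sum_invGenExp {ℓ : ℕ} (hℓ : 0 < ℓ) (t : Fin 4 → ℕ) (ht0 : t 0 = 1)
    (b : Fin 4 → ℤ) (hb : (ℓ : ℤ) ∣ ∑ j, b j * (t j : ℤ)) :
    ∃ c : Fin 4 → ℤ, (∀ i : Fin 3, c i.succ = b i.succ) ∧ b = ∑ j, c j • invGenExp ℓ t j := by
  obtain ⟨d, hd⟩ := hb
  rw [Fin.sum_univ_succ, ht0] at hd
  push_cast at hd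
  rw [mul_one] at hd
  -- `q = d - ∑_{i} t_{i+1} b_{i+1}`
  refine ⟨fun j => if j = 0 then d - ∑ i : Fin 3, (t i.succ : ℤ) * b i.succ else b j,
    fun i => if_neg (Fin.succ_ne_zero i), ?_⟩
  have hℓ1 : (((ℓ - 1 : ℕ) : ℤ)) = (ℓ : ℤ) - 1 := by
    rw [Nat.cast_sub (Nat.one_le_of_lt hℓ), Nat.cast_one]
  funext m
  rw [Finset.sum_apply, Fin.sum_univ_succ]
  simp only [Pi.smul_apply, smul_eq_mul, invGenExp, if_true, Fin.succ_ne_zero, if_false]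
  by_cases hm : m = 0
  · subst hm
    simp only [if_true, Nat.cast_mul, hℓ1]
    have : ∀ i : Fin 3, ((0 : Fin 4) = i.succ) = False := fun i =>
      eq_false (Fin.succ_ne_zero i).symm
    simp only [this, if_false, zero_add]
    simp only [Fin.sum_univ_three] at hd ⊢
    linear_combination hd
  · obtain ⟨i, rfl⟩ : ∃ i : Fin 3, m = i.succ := ⟨m.pred hm, (Fin.succ_pred m hm).symm⟩
    simp only [Fin.succ_ne_zero, if_false, mul_zero, zero_add, add_zero, Fin.succ_inj]
    simp only [mul_ite, mul_one, mul_zero, Finset.sum_ite_eq, Finset.mem_univ, if_true]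

/-- Every invariant Laurent monomial lies in the field generated by the generators. [folklore] -/
theorem lmon_mem_adjoin_invGen (x : Fin 4 → L) (hx0 : ∀ j, x j ≠ 0) {ℓ : ℕ} (hℓ : 0 < ℓ)
    (t : Fin 4 → ℕ) (ht0 : t 0 = 1) (b : Fin 4 → ℤ) (hb : (ℓ : ℤ) ∣ ∑ j, b j * (t j : ℤ)) :
    lmon x b ∈ IntermediateField.adjoin k (Set.range (invGen x ℓ t)) := by
  obtain ⟨c, -, hbc⟩ := exists_eq_sum_invGenExp hℓ t ht0 b hb
  rw [hbc, lmon_sum_zsmul x hx0]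
  refine prod_mem fun j _ => zpow_mem ?_ _
  rw [lmon_invGenExp x hx0]
  exact IntermediateField.subset_adjoin k _ ⟨j, rfl⟩

/-- **PART C2, THE INVARIANT SUB-TOP IS `k(W)`**: for a diagonal tame action with characters `t`,
`t₀ = 1`, an element of `k(x)` is `σ`-fixed iff it lies in `k(W)`. [CossartPiltant2008, Prop. 6.2]
[folklore] -/
theorem fixed_iff_mem_adjoin_invGen (σ : L ≃ₐ[k] L) {ℓ : ℕ} (hℓ : 0 < ℓ) (hℓk : (ℓ : k) ≠ 0)
    {ζ : k} (hζ : IsPrimitiveRoot ζ ℓ) (x : Fin 4 → L) (hx0 : ∀ j, x j ≠ 0) (t : Fin 4 → ℕ)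
    (ht0 : t 0 = 1) (heig : ∀ j, σ (x j) = algebraMap k L (ζ ^ t j) * x j)
    {z : L} (hz : z ∈ IntermediateField.adjoin k (Set.range x)) :
    σ z = z ↔ z ∈ IntermediateField.adjoin k (Set.range (invGen x ℓ t)) := by
  constructor
  · intro hσz
    exact mem_of_fixed σ hℓ hℓk hζ x hx0 t heig
      (IntermediateField.adjoin k (Set.range (invGen x ℓ t))).toSubfield
      (fun c => (IntermediateField.adjoin k _).algebraMap_mem c)
      (fun b hb => lmon_mem_adjoin_invGen x hx0 hℓ t ht0 b hb) hz hσz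
  · intro hzW
    -- `σ` fixes `k(W)` since it fixes the generators
    refine IntermediateField.adjoin_induction k (p := fun y _ => σ y = y) ?_ ?_ ?_ ?_ ?_ hzW
    · rintro _ ⟨j, rfl⟩; exact sigma_invGen σ x hℓ hζ.pow_eq_one t ht0 heig j
    · intro c; exact σ.commutes c
    · intro a b _ _ ha hb; rw [map_add, ha, hb]
    · intro a _ ha; rw [map_inv₀, ha]
    · intro a b _ _ ha hb; rw [map_mul, ha, hb]

/-- The generator PATTERN as polynomials: `f₀ = X₀^ℓ`, `f_j = X_j X₀^{(ℓ-1)t_j}`. [folklore] -/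
noncomputable def invGenPoly (k : Type) [Field k] (ℓ : ℕ) (t : Fin 4 → ℕ) :
    Fin 4 → MvPolynomial (Fin 4) k :=
  fun j => if j = 0 then MvPolynomial.X 0 ^ ℓ
    else MvPolynomial.X j * MvPolynomial.X 0 ^ ((ℓ - 1) * t j)

/-- `aeval_invGenPoly`: Bookkeeping / simp lemma of the eigen-ladder kernel (decomp-res lens-1 g24
«EigenLadder»), VERBATIM from the lens's tree file (see the module docstring); the statement is its type. [folklore] -/
theorem aeval_invGenPoly (x : Fin 4 → L) (ℓ : ℕ) (t : Fin 4 → ℕ) (j : Fin 4) :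
    MvPolynomial.aeval x (invGenPoly k ℓ t j) = invGen x ℓ t j := by
  by_cases hj : j = 0
  · rw [hj, invGen_zero]; simp [invGenPoly]
  · obtain ⟨i, rfl⟩ : ∃ i : Fin 3, j = i.succ := ⟨j.pred hj, (Fin.succ_pred j hj).symm⟩
    rw [invGen_succ]; simp [invGenPoly, Fin.succ_ne_zero]

/-- The generator monomials are algebraically independent in the polynomial ring (the polynomial
ring is ALGEBRAIC over them: `X₀^ℓ = f₀`, `X_j · X₀^{n_j} = f_j`, and has transcendence degree `4`).
[folklore] -/
theorem algebraicIndependent_invGenPoly (k : Type) [Field k] {ℓ : ℕ} (hℓ : 0 < ℓ) (t : Fin 4 → ℕ) :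
    AlgebraicIndependent k (invGenPoly k ℓ t) := by
  have hfR : ∀ j, invGenPoly k ℓ t j ∈ Algebra.adjoin k (Set.range (invGenPoly k ℓ t)) :=
    fun j => Algebra.subset_adjoin ⟨j, rfl⟩
  have hf0 : invGenPoly k ℓ t 0 = MvPolynomial.X 0 ^ ℓ := if_pos rfl
  have hfsucc : ∀ i : Fin 3, invGenPoly k ℓ t i.succ =
      MvPolynomial.X i.succ * MvPolynomial.X 0 ^ ((ℓ - 1) * t i.succ) := fun i =>
    if_neg (Fin.succ_ne_zero i)
  have hX0 : IsAlgebraic (Algebra.adjoin k (Set.range (invGenPoly k ℓ t)))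
      (MvPolynomial.X 0 : MvPolynomial (Fin 4) k) := by
    refine IsAlgebraic.of_pow hℓ ?_
    have h1 : (MvPolynomial.X 0 : MvPolynomial (Fin 4) k) ^ ℓ =
        algebraMap (Algebra.adjoin k (Set.range (invGenPoly k ℓ t))) (MvPolynomial (Fin 4) k)
          ⟨invGenPoly k ℓ t 0, hfR 0⟩ := by
      rw [Subalgebra.algebraMap_def, Algebra.algebraMap_self, RingHom.id_apply]
      exact hf0.symm
    rw [h1]; exact isAlgebraic_algebraMap _
  have hX : ∀ m : Fin 4, IsAlgebraic (Algebra.adjoin k (Set.range (invGenPoly k ℓ t)))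
      (MvPolynomial.X m : MvPolynomial (Fin 4) k) := by
    intro m
    by_cases hm : m = 0
    · rw [hm]; exact hX0
    · obtain ⟨i, rfl⟩ : ∃ i : Fin 3, m = i.succ := ⟨m.pred hm, (Fin.succ_pred m hm).symm⟩
      refine IsAlgebraic.of_mul (y := MvPolynomial.X 0 ^ ((ℓ - 1) * t i.succ))
        (mem_nonZeroDivisors_of_ne_zero (pow_ne_zero _ (MvPolynomial.X_ne_zero 0))) (hX0.pow _) ?_
      have h1 : (MvPolynomial.X 0 : MvPolynomial (Fin 4) k) ^ ((ℓ - 1) * t i.succ) *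
          MvPolynomial.X i.succ =
          algebraMap (Algebra.adjoin k (Set.range (invGenPoly k ℓ t))) (MvPolynomial (Fin 4) k)
            ⟨invGenPoly k ℓ t i.succ, hfR i.succ⟩ := by
        rw [Subalgebra.algebraMap_def, Algebra.algebraMap_self, RingHom.id_apply, mul_comm]
        exact (hfsucc i).symm
      rw [h1]; exact isAlgebraic_algebraMap _
  haveI : Algebra.IsAlgebraic (Algebra.adjoin k (Set.range (invGenPoly k ℓ t)))
      (MvPolynomial (Fin 4) k) := by
    have halg : (Algebra.adjoin (Algebra.adjoin k (Set.range (invGenPoly k ℓ t))) (Set.range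
        (MvPolynomial.X : Fin 4 → MvPolynomial (Fin 4) k))).IsAlgebraic :=
      Algebra.isAlgebraic_adjoin_iff.mpr (by rintro _ ⟨m, rfl⟩; exact hX m)
    have hsub : Set.range (MvPolynomial.X : Fin 4 → MvPolynomial (Fin 4) k) ⊆
        ((Algebra.adjoin (Algebra.adjoin k (Set.range (invGenPoly k ℓ t))) (Set.range
          (MvPolynomial.X : Fin 4 → MvPolynomial (Fin 4) k))).restrictScalars k :
            Set (MvPolynomial (Fin 4) k)) := by
      rw [Subalgebra.coe_restrictScalars]
      exact Algebra.subset_adjoin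
    have htop : ∀ p : MvPolynomial (Fin 4) k, p ∈ Algebra.adjoin
        (Algebra.adjoin k (Set.range (invGenPoly k ℓ t)))
        (Set.range (MvPolynomial.X : Fin 4 → MvPolynomial (Fin 4) k)) := by
      intro p
      have hp : p ∈ Algebra.adjoin k
          (Set.range (MvPolynomial.X : Fin 4 → MvPolynomial (Fin 4) k)) := by
        rw [MvPolynomial.adjoin_range_X]; exact Algebra.mem_top
      exact (Subalgebra.mem_restrictScalars k).mp (Algebra.adjoin_le hsub hp)
    exact ⟨fun p => halg p (htop p)⟩
  have hle : Cardinal.mk (Fin 4) ≤ Algebra.trdeg k (MvPolynomial (Fin 4) k) := by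
    rw [MvPolynomial.trdeg_of_isDomain, Cardinal.lift_id]
  exact (Algebra.IsAlgebraic.isTranscendenceBasis_of_le_trdeg_of_finite k (invGenPoly k ℓ t) hle).1

/-- **The invariant generators are ALGEBRAICALLY INDEPENDENT** (so `k(W)` is purely transcendental of
transcendence degree `4`). [folklore] -/
theorem algebraicIndependent_invGen {x : Fin 4 → L} (hx : AlgebraicIndependent k x) {ℓ : ℕ}
    (hℓ : 0 < ℓ) (t : Fin 4 → ℕ) : AlgebraicIndependent k (invGen x ℓ t) := by
  have h := hx.aeval_of_algebraicIndependent (algebraicIndependent_invGenPoly k hℓ t)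
  have hfun : (fun i => MvPolynomial.aeval x (invGenPoly k ℓ t i)) = invGen x ℓ t :=
    funext fun j => aeval_invGenPoly x ℓ t j
  rwa [hfun] at h

end Generators

end Summit.ResolutionOfSingularities.ResolutionOfSingularities.Theorems.EigenLadderLU
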